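import Mathlib
import Summits.Ventures.HodgeRepro.Tier4.Common.LocalTorusCompact
import Summits.Ventures.HodgeRepro.Tier4.Line1.FiniteLevelIsolation

/-!
# Tier4/Common/TorusInfCompact — the ARCHIMEDEAN TORUS `T_∞ = T(𝔸) ∩ G_∞` of a row plane is COMPACT when every
infinite place is a real CM place

Blind re-derivation cell `pub-hodge-repro`, Tier 4 «prove the step» (README §9–§10), seat t4-typer-2 (gen 4).
Target tree path `lean/Summits/Ventures/HodgeRepro/Tier4/Common/TorusInfCompact.lean`.  Imports: Mathlib,
`Common.LocalTorusCompact` (the ellipse bound `abs_realEntry_blockOf_le`, `blockBound`, the block description of the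
torus through `RowWeights.exists_blockOf_of_mem_torusT`, the closed embedding `g ↦ (g, g⁻¹)`) and
`Line1.FiniteLevelIsolation` (`infinitePart W = {g | finM (mat g) = 1}`, `isClosed_infinitePart`).

WHY (plan-4 g3, bus S14455 Part 6 (ii), the CM input `CentreFinFinite` of the `horb` chain — C-L4-CMUNITS): with
`T_∞` compact, the projection `T(𝔸) → T_f` is proper, so the image of the discrete `Z(k)` (L1's `rationalOf_discrete`)
meets every compact of `T_f` in a finite set and is discrete (`Common/DiscreteImage`).  Here `T_∞` is proved compact
for the row planes `ofLinesRow q a b ε` under `hreal : ∀ w, w.IsReal` and `hcm : ∀ w, IsCMAt q w` — exactly the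
place-binder pair LINE L4 already displays for `hcompT` (S14178) — by the box argument of `LocalTorusCompact` run at
ALL infinite places at once: an element of `T(𝔸)` is `blockDiag4R (x₀•1 + y₀•ω) (x₁•1 + y₁•ω)` with the norm-one
conditions; at every real CM place the condition is an ellipse, so every real component of every entry is bounded by
`blockBound q w`; the finite part of an element of `G_∞` is the identity; hence `T_∞` is a closed subset of the
preimage, under the closed embedding `g ↦ (g, g⁻¹)`, of the compact box `torusBoxAll ×ˢ op '' torusBoxAll`
(Tychonoff over the places and the entries).

* `entryBoxAll`, `isCompact_entryBoxAll`, `mem_entryBoxAll` — adeles with all real components in `[−C w, C w]` and a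
  prescribed finite part; `torusBoxAll`, `isCompact_torusBoxAll` — the matrix box;
* `finPart_entry_of_mem_infinitePart` — the finite part of an element of `G_∞` has identity entries;
* `mem_torusBoxAll_of_mem_torusT_of_mem_infinitePart` — the matrix of an element of `T_∞` lies in the box;
* **`isCompact_torusT_inter_infinitePart_ofLinesRow`** — `IsCompact ((torusT W : Set (GA W)) ∩ infinitePart W)`;
  **`isCompact_infinitePart_subgroupOf_torusT_ofLinesRow`** — the same as a subset of `T(𝔸)` (the carrier of
  `torusInf W := (infinitePart W).subgroupOf (torusT W)` of C-L4-TORUSPROD, by `rfl`);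
  **`compactSpace_infinitePart_subgroupOf_torusT_ofLinesRow`** — the typeclass form.

The seesaw plane of LINE L4 is `(mixedRow q a₀ a₂).withTransportedTorus g g'` with `mixedRow q a b = ofLinesRow q a b (-1)`
and an unchanged `T`; its `T_∞` is this set.  Junk test: with one non-CM real place (`t_w² ≥ 4 n_w`) the norm-one
condition is a hyperbola and `T_∞` is NOT compact — crit-1's counter-model `k = ℚ(√2)`; the hypothesis `hcm` is used at
every place.

Nothing here says anything about the status of the Hodge conjecture for CM abelian varieties, which is NOT proved
(HC_CM is NOT proved by anyone in this repository).
-/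

set_option autoImplicit false

noncomputable section

namespace Summit.Ventures.HodgeRepro.Tier4.Common

open NumberField IsDedekindDomain Matrix Set Topology Summit.Ventures.HodgeRepro.Tier4.Line1

section BoxAll

variable {k : Type} [Field k] [NumberField k]

/-- The adeles whose real component at every (real) infinite place `w` lies in `[−C w, C w]` and whose finite part is
`cFin`: the image of the compact product of interval preimages under `z ↦ (z, cFin)`. -/
def entryBoxAll (hreal : ∀ w : InfinitePlace k, w.IsReal) (C : InfinitePlace k → ℝ)
    (cFin : FiniteAdeleRing (𝓞 k) k) : Set (Ad k) :=
  (fun z : InfiniteAdeleRing k => ((z, cFin) : Ad k)) ''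
    (Set.pi Set.univ fun w : InfinitePlace k =>
      (InfinitePlace.Completion.extensionEmbeddingOfIsReal (hreal w)) ⁻¹' Set.Icc (-C w) (C w))

/-- The entry box over all places is compact (Tychonoff over the places; the real embedding is a closed embedding). -/
theorem isCompact_entryBoxAll (hreal : ∀ w : InfinitePlace k, w.IsReal) (C : InfinitePlace k → ℝ)
    (cFin : FiniteAdeleRing (𝓞 k) k) : IsCompact (entryBoxAll hreal C cFin) := by
  refine IsCompact.image ?_ ?_
  · exact isCompact_univ_pi fun w =>
      (InfinitePlace.Completion.isometry_extensionEmbeddingOfIsReal (hreal w)).isClosedEmbedding.isCompact_preimage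
        isCompact_Icc
  · exact continuous_id.prodMk continuous_const

/-- Membership in the entry box from the bounds at every place and the finite part. -/
theorem mem_entryBoxAll (hreal : ∀ w : InfinitePlace k, w.IsReal) (C : InfinitePlace k → ℝ)
    (cFin : FiniteAdeleRing (𝓞 k) k) {a : Ad k} (hbound : ∀ w, |realEntry (hreal w) a| ≤ C w)
    (hfin : finPart k a = cFin) : a ∈ entryBoxAll hreal C cFin := by
  refine ⟨infPart k a, ?_, ?_⟩
  · intro w _
    show InfinitePlace.Completion.extensionEmbeddingOfIsReal (hreal w) (infPart k a w) ∈ Set.Icc (-C w) (C w)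
    rw [← realEntry_eq (hreal w) a]
    exact abs_le.1 (hbound w)
  · exact Prod.ext rfl hfin.symm

/-- The compact box of adelic matrices: identity finite parts, real components of the entries in `[−C w, C w]` at
every place. -/
def torusBoxAll (hreal : ∀ w : InfinitePlace k, w.IsReal) (C : InfinitePlace k → ℝ) : Set (M4 k) :=
  Set.pi Set.univ fun i => Set.pi Set.univ fun j => entryBoxAll hreal C (finPart k ((1 : M4 k) i j))

/-- The matrix box is compact (Tychonoff over the entries). -/
theorem isCompact_torusBoxAll (hreal : ∀ w : InfinitePlace k, w.IsReal) (C : InfinitePlace k → ℝ) :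
    IsCompact (torusBoxAll hreal C) :=
  isCompact_univ_pi fun _ => isCompact_univ_pi fun _ => isCompact_entryBoxAll hreal C _

/-- The finite part of an entry of an element of `G_∞` is the corresponding entry of the identity. -/
theorem finPart_entry_of_mem_infinitePart {W : PlaneData k} {g : GA W} (hg : g ∈ infinitePart W) (i j : Fin 4) :
    finPart k (GA.mat W g i j) = finPart k ((1 : M4 k) i j) := by
  have h : finM k (GA.mat W g) = finM k (1 : M4 k) := by rw [(mem_infinitePart W g).1 hg, finM_one]
  have h' := congrArg (fun M : Matrix (Fin 4) (Fin 4) (FiniteAdeleRing (𝓞 k) k) => M i j) h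
  simpa only [finM, Matrix.map_apply] using h'

variable (q : QuadData k) (a b ε : k)

/-- **The matrix of an element of `T_∞` lies in the box** (`C w := blockBound q w`): the block description of the
torus gives the norm-one conditions, the ellipse bound holds at every real CM place, the finite part is the identity. -/
theorem mem_torusBoxAll_of_mem_torusT_of_mem_infinitePart (ha : a ≠ 0) (hb : b ≠ 0) (hε : ε ≠ 0)
    (hreal : ∀ w : InfinitePlace k, w.IsReal) (hcm : ∀ w, IsCMAt q w) {κ : GA (PlaneData.ofLinesRow q a b ε)}
    (hT : κ ∈ torusT (PlaneData.ofLinesRow q a b ε)) (hinf : κ ∈ infinitePart (PlaneData.ofLinesRow q a b ε)) :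
    GA.mat (PlaneData.ofLinesRow q a b ε) κ ∈ torusBoxAll hreal (fun w => blockBound q w) := by
  obtain ⟨x₀, y₀, x₁, y₁, hmat, hN₀, hN₁⟩ := exists_blockOf_of_mem_torusT q a b ε ha hb hε κ hT
  have hbound : ∀ (w : InfinitePlace k) (i j : Fin 4),
      |realEntry (hreal w) (GA.mat (PlaneData.ofLinesRow q a b ε) κ i j)| ≤ blockBound q w := by
    intro w i j
    rw [hmat]
    exact abs_realEntry_blockDiag4R_le (hreal w) _ _ _ (blockBound_nonneg q w)
      (abs_realEntry_blockOf_le q (hreal w) (hcm w) x₀ y₀ hN₀)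
      (abs_realEntry_blockOf_le q (hreal w) (hcm w) x₁ y₁ hN₁) i j
  refine Set.mem_univ_pi.2 fun i => Set.mem_univ_pi.2 fun j =>
    mem_entryBoxAll hreal _ _ (fun w => hbound w i j) ?_
  exact finPart_entry_of_mem_infinitePart hinf i j

/-- **THE ARCHIMEDEAN TORUS OF A ROW PLANE IS COMPACT when every infinite place is a real CM place**: `T_∞` is closed
(`isClosed_torusT`, `isClosed_infinitePart`) and lies inside the preimage of the compact `torusBoxAll ×ˢ op '' torusBoxAll`
under the closed embedding `g ↦ (g, g⁻¹)` (both `κ` and `κ⁻¹` lie in `T_∞`). -/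
theorem isCompact_torusT_inter_infinitePart_ofLinesRow (ha : a ≠ 0) (hb : b ≠ 0) (hε : ε ≠ 0)
    (hreal : ∀ w : InfinitePlace k, w.IsReal) (hcm : ∀ w, IsCMAt q w) :
    IsCompact ((torusT (PlaneData.ofLinesRow q a b ε) : Set (GA (PlaneData.ofLinesRow q a b ε))) ∩
      (infinitePart (PlaneData.ofLinesRow q a b ε) : Set (GA (PlaneData.ofLinesRow q a b ε)))) := by
  set W := PlaneData.ofLinesRow q a b ε with hW
  set C : InfinitePlace k → ℝ := fun w => blockBound q w with hC
  have hP : IsCompact ((torusBoxAll hreal C) ×ˢ (MulOpposite.op '' torusBoxAll hreal C)) :=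
    (isCompact_torusBoxAll hreal C).prod ((isCompact_torusBoxAll hreal C).image MulOpposite.continuous_op)
  have hpre : IsCompact ((fun g : GA W => Units.embedProduct (M4 k) (g : GL4 k)) ⁻¹'
      ((torusBoxAll hreal C) ×ˢ (MulOpposite.op '' torusBoxAll hreal C))) :=
    (isClosedEmbedding_embed W).isCompact_preimage hP
  refine hpre.of_isClosed_subset ((isClosed_torusT W).inter (isClosed_infinitePart W)) ?_
  rintro κ ⟨hT, hinf⟩
  show Units.embedProduct (M4 k) (κ : GL4 k) ∈ (torusBoxAll hreal C) ×ˢ (MulOpposite.op '' torusBoxAll hreal C)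
  rw [Units.embedProduct_apply]
  refine ⟨mem_torusBoxAll_of_mem_torusT_of_mem_infinitePart q a b ε ha hb hε hreal hcm hT hinf, ?_⟩
  refine ⟨GA.mat W κ⁻¹, mem_torusBoxAll_of_mem_torusT_of_mem_infinitePart q a b ε ha hb hε hreal hcm
    ((torusT W).inv_mem hT) ((infinitePart W).inv_mem hinf), ?_⟩
  rfl

/-- The same statement inside `T(𝔸)`: the carrier of `(infinitePart W).subgroupOf (torusT W)` (= `torusInf W` of
C-L4-TORUSPROD) is a compact subset of `torusT W` — the preimage of `T_∞` under the closed embedding `Subtype.val`. -/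
theorem isCompact_infinitePart_subgroupOf_torusT_ofLinesRow (ha : a ≠ 0) (hb : b ≠ 0) (hε : ε ≠ 0)
    (hreal : ∀ w : InfinitePlace k, w.IsReal) (hcm : ∀ w, IsCMAt q w) :
    IsCompact (((infinitePart (PlaneData.ofLinesRow q a b ε)).subgroupOf (torusT (PlaneData.ofLinesRow q a b ε)) :
      Subgroup (torusT (PlaneData.ofLinesRow q a b ε))) : Set (torusT (PlaneData.ofLinesRow q a b ε))) := by
  set W := PlaneData.ofLinesRow q a b ε with hW
  have hemb : Topology.IsClosedEmbedding (Subtype.val : torusT W → GA W) :=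
    (isClosed_torusT W).isClosedEmbedding_subtypeVal
  have hc := hemb.isCompact_preimage (isCompact_torusT_inter_infinitePart_ofLinesRow q a b ε ha hb hε hreal hcm)
  refine hc.of_isClosed_subset ?_ ?_
  · rw [Subgroup.coe_subgroupOf]
    exact (isClosed_infinitePart W).preimage continuous_subtype_val
  · intro t ht
    exact ⟨t.2, Subgroup.mem_subgroupOf.1 ht⟩

/-- The typeclass form: `(infinitePart W).subgroupOf (torusT W)` is a compact space. -/
theorem compactSpace_infinitePart_subgroupOf_torusT_ofLinesRow (ha : a ≠ 0) (hb : b ≠ 0) (hε : ε ≠ 0)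
    (hreal : ∀ w : InfinitePlace k, w.IsReal) (hcm : ∀ w, IsCMAt q w) :
    CompactSpace ((infinitePart (PlaneData.ofLinesRow q a b ε)).subgroupOf (torusT (PlaneData.ofLinesRow q a b ε))) :=
  isCompact_iff_compactSpace.1 (isCompact_infinitePart_subgroupOf_torusT_ofLinesRow q a b ε ha hb hε hreal hcm)

end BoxAll

end Summit.Ventures.HodgeRepro.Tier4.Common

end
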